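import Literature.Probability.Percolation.SeededSymmetry
import Literature.Probability.LatticeModels.DomainDiscretisation
import HarnessLib

/-!
# The generating lattice symmetries are isometries of the embedded lattice

Topic `Probability/Percolation`.  Support file (proofs, no named fact) for the named fact
`SchrammSmirnov2011_thm_1_7` (the landing count of the proof of Prop. 4.1, Ann. Probab. 39 (2011),
§4): the far-distance hypothesis of the window bounds (`real_patternAt_le_two_factor`) is stated in
window coordinates, `R ≤ dist (meshPoint 1 (ψ.σ u)) (meshPoint 1 (j,0))`; to feed it from distances
in the original lattice one needs that the frames `ψ` used (composites of translations, the
reflection and the transposition) preserve the distances of mesh points: `LatticeSym.IsIsometric`,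
closed under `trans`, holding for `shift`, `reflY`, `swap` (`isIsometric_shift/reflY/swap`), and
scaling to every mesh (`IsIsometric.dist_meshPoint`).

## References

* O. Schramm, S. Smirnov, *On the scaling limits of planar percolation*, Ann. Probab. 39 (2011)
  1768–1814, arXiv:1101.5820, §4, proof of Prop. 4.1. [SchrammSmirnov2011]
-/

noncomputable section

open Literature.Probability.LatticeModels

namespace Literature.Probability.Percolation

namespace Seeded

namespace LatticeSym

/-- **Isometric lattice symmetries** (for the mesh-`1` embedding). [folklore] -/
def IsIsometric (ψ : LatticeSym) : Prop :=
  ∀ u v : Site 2, dist (meshPoint 1 (ψ.σ u)) (meshPoint 1 (ψ.σ v)) = dist (meshPoint 1 u) (meshPoint 1 v)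

/-- The distance of mesh points in coordinates. [folklore] -/
theorem dist_meshPoint_eq (δ : ℝ) (u v : Site 2) :
    dist (meshPoint δ u) (meshPoint δ v) = |δ| * Real.sqrt (((u 0 : ℝ) - v 0) ^ 2 + ((u 1 : ℝ) - v 1) ^ 2) := by
  rw [Complex.dist_eq, Complex.norm_eq_sqrt_sq_add_sq]
  simp only [Complex.sub_re, Complex.sub_im, meshPoint_re, meshPoint_im]
  rw [← mul_sub, ← mul_sub, mul_pow, mul_pow, ← mul_add, Real.sqrt_mul (sq_nonneg _), Real.sqrt_sq_eq_abs]

/-- Mesh-`δ` distances are `|δ|` times mesh-`1` distances. [folklore] -/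
theorem dist_meshPoint_eq_mul (δ : ℝ) (u v : Site 2) :
    dist (meshPoint δ u) (meshPoint δ v) = |δ| * dist (meshPoint 1 u) (meshPoint 1 v) := by
  rw [dist_meshPoint_eq, dist_meshPoint_eq, abs_one, one_mul]

/-- An isometric symmetry preserves distances at every mesh. [folklore] -/
theorem IsIsometric.dist_meshPoint {ψ : LatticeSym} (h : ψ.IsIsometric) (δ : ℝ) (u v : Site 2) :
    dist (meshPoint δ (ψ.σ u)) (meshPoint δ (ψ.σ v)) = dist (meshPoint δ u) (meshPoint δ v) := by
  rw [dist_meshPoint_eq_mul δ (ψ.σ u), dist_meshPoint_eq_mul δ u, h u v]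

/-- Composites of isometric symmetries are isometric. [folklore] -/
theorem IsIsometric.trans {ψ ψ' : LatticeSym} (h : ψ.IsIsometric) (h' : ψ'.IsIsometric) : (ψ.trans ψ').IsIsometric :=
  fun u v => by
    change dist (meshPoint 1 (ψ'.σ (ψ.σ u))) (meshPoint 1 (ψ'.σ (ψ.σ v))) = _
    rw [h', h]

/-- **Translations are isometric.** [folklore] -/
theorem isIsometric_shift (t : Site 2) : (shift t).IsIsometric := fun u v => by
  rw [dist_meshPoint_eq, dist_meshPoint_eq]
  congr 2
  have h0 : ((shift t).σ u) 0 = u 0 + t 0 := rfl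
  have h1 : ((shift t).σ u) 1 = u 1 + t 1 := rfl
  have h0' : ((shift t).σ v) 0 = v 0 + t 0 := rfl
  have h1' : ((shift t).σ v) 1 = v 1 + t 1 := rfl
  rw [h0, h1, h0', h1']
  push_cast
  ring

/-- **The reflection is isometric.** [folklore] -/
theorem isIsometric_reflY : reflY.IsIsometric := fun u v => by
  rw [dist_meshPoint_eq, dist_meshPoint_eq]
  congr 2
  have h0 : (reflY.σ u) 0 = u 0 := rfl
  have h1 : (reflY.σ u) 1 = -u 1 := rfl
  have h0' : (reflY.σ v) 0 = v 0 := rfl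
  have h1' : (reflY.σ v) 1 = -v 1 := rfl
  rw [h0, h1, h0', h1']
  push_cast
  ring

/-- **The transposition is isometric.** [folklore] -/
theorem isIsometric_swap : swap.IsIsometric := fun u v => by
  rw [dist_meshPoint_eq, dist_meshPoint_eq]
  congr 2
  have h0 : (swap.σ u) 0 = u 1 := rfl
  have h1 : (swap.σ u) 1 = u 0 := rfl
  have h0' : (swap.σ v) 0 = v 1 := rfl
  have h1' : (swap.σ v) 1 = v 0 := rfl
  rw [h0, h1, h0', h1']
  ring

end LatticeSym

end Seeded

end Literature.Probability.Percolation

end
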